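import Literature.Computability.MetaComplexity.CuttingPlanesTree
import Literature.Computability.Complexity.ProofComplexityHaken
import HarnessLib

/-!
# Polynomial-size cutting planes refutations of the pigeonhole principle (Cook–Coullard–Turán 1987)

The founding example of the strength of cutting planes (Cook–Coullard–Turán 1987, §3;
Krajíček 2019, §6.3): `PHP^m_n` — `pigeonholeCNF m n`, `m > n` pigeons — has a cutting planes
refutation with at most `(m + n + 1)³` lines all of whose integers are small (norm
`≤ 4 (m + n + 1)²`): `pigeonhole_cuttingPlanes_upperBound`.  Together with Haken's theorem
(`haken_pigeonhole_holds`, proved in the tree) this is the classical EXPONENTIAL SEPARATION of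
cutting planes (even with small coefficients) from resolution
(`cuttingPlanes_exponential_speedup_pigeonhole`).

The refutation (variables `x_{ij} = i n + j`): for each hole `j`, derive `-∑_{i<k} x_{ij} ≥ -1`
for `k = 1, …, m` (`PigeonholeCP.S`) — from `-∑_{i<k} x_{ij} ≥ -1` multiply by `k - 1`, add the
`k` hole axioms `-x_{ij} - x_{kj} ≥ -1` (`i < k`) to get `-k ∑_{i≤k} x_{ij} ≥ -(2k-1)` and DIVIDE by
`k` with rounding, `⌈-(2k-1)/k⌉ = -1`; then add up the holes (`-∑_{ij} x_{ij} ≥ -n`) and the pigeon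
axioms (`∑_{ij} x_{ij} ≥ m`) to reach `0 ≥ m - n > 0`.  The derivation is tree-like and is
assembled with `CPTree` (`CuttingPlanesTree.lean`).

## References

* W. Cook, C. R. Coullard, Gy. Turán, *On the complexity of cutting-plane proofs*, Discrete
  Appl. Math. 18 (1987) 25–38, §3 [CookCoullardTuran1987].
* J. Krajíček, *Proof complexity* (CUP 2019), §6.3 [KrajicekProofComplexity2019].
* A. Haken, *The intractability of resolution*, TCS 39 (1985) [Haken1985].
-/

namespace Literature.Computability.MetaComplexity

open Finset Literature.Computability.Complexity CPLine

namespace PigeonholeCP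

/-! ### Variables and clauses -/

/-- The variable `x_{ij}` ("pigeon `i` sits in hole `j`") of `pigeonholeCNF m n`: `i n + j`.
[cite: Haken1985, §1] -/
def xv (n i j : ℕ) : ℕ := i * n + j

/-- The unit coefficient vector of `x_{ij}`. [folklore] -/
noncomputable def e (n i j : ℕ) : ℕ →₀ ℤ := Finsupp.single (xv n i j) 1

/-- `x_{ij}` determines `(i, j)` (for `j, j' < n`). [folklore] -/
theorem xv_inj {n i i' j j' : ℕ} (hj : j < n) (hj' : j' < n) (h : xv n i j = xv n i' j') : i = i' ∧ j = j' := by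
  simp only [xv] at h
  have h1 : (i * n + j) % n = j := by
    rw [Nat.add_mod, Nat.mul_mod_left, Nat.zero_add, Nat.mod_mod, Nat.mod_eq_of_lt hj]
  have h2 : (i' * n + j') % n = j' := by
    rw [Nat.add_mod, Nat.mul_mod_left, Nat.zero_add, Nat.mod_mod, Nat.mod_eq_of_lt hj']
  have hjj : j = j' := by rw [← h1, h, h2]
  subst hjj
  refine ⟨?_, rfl⟩
  have hn : 0 < n := by omega
  exact Nat.eq_of_mul_eq_mul_right hn (by omega)

/-- The pigeon clause `⋁_{j<n} x_{ij}`. [cite: Haken1985, §1] -/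
def pigeonClause (n i : ℕ) : Clause ℕ := (List.range n).map fun j => (i * n + j, true)

/-- The hole clause `¬x_{ij} ∨ ¬x_{i'j}`. [cite: Haken1985, §1] -/
def holeClause (n j i i' : ℕ) : Clause ℕ := [(i * n + j, false), (i' * n + j, false)]

/-- Pigeon clauses are clauses of `PHP^m_n`. [cite: Haken1985, §1] -/
theorem pigeonClause_mem {m n i : ℕ} (hi : i < m) : pigeonClause n i ∈ pigeonholeCNF m n := by
  unfold pigeonholeCNF pigeonClause
  exact List.mem_append_left _ (List.mem_map.2 ⟨i, List.mem_range.2 hi, rfl⟩)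

/-- Hole clauses are clauses of `PHP^m_n`. [cite: Haken1985, §1] -/
theorem holeClause_mem {m n j i i' : ℕ} (hj : j < n) (hii' : i < i') (hi' : i' < m) :
    holeClause n j i i' ∈ pigeonholeCNF m n := by
  unfold pigeonholeCNF holeClause
  refine List.mem_append_right _ (List.mem_flatMap.2 ⟨j, List.mem_range.2 hj, List.mem_flatMap.2
    ⟨i', List.mem_range.2 hi', List.mem_map.2 ⟨i, List.mem_range.2 hii', rfl⟩⟩⟩)

/-! ### The lines of the refutation -/

/-- The pigeon axiom as a line: `∑_{j<n} x_{ij} ≥ 1`. [cite: CookCoullardTuran1987, §3] -/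
theorem ofClause_pigeonClause (n i : ℕ) :
    ofClause (pigeonClause n i) = ⟨∑ j ∈ Finset.range n, e n i j, 1⟩ := by
  have hnd : (pigeonClause n i).Nodup := by
    unfold pigeonClause
    refine (List.nodup_range).map fun j j' h => ?_
    simpa using h
  unfold ofClause
  congr 1
  · rw [List.sum_toFinset _ hnd, pigeonClause, List.map_map, ← List.sum_toFinset _ List.nodup_range,
      List.toFinset_range]
    refine Finset.sum_congr rfl fun j _ => ?_
    simp [litCoeff, e, xv]
  · have h0 : ((pigeonClause n i).toFinset.filter fun l => l.2 = false) = ∅ := by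
      refine Finset.filter_eq_empty_iff.2 fun l hl => ?_
      rw [List.mem_toFinset, pigeonClause, List.mem_map] at hl
      obtain ⟨j, -, rfl⟩ := hl
      simp
    rw [h0, Finset.card_empty]
    norm_num

/-- The hole axiom as a line: `-x_{ij} - x_{i'j} ≥ -1` (`x_{ij} ≠ x_{i'j}`).
[cite: CookCoullardTuran1987, §3] -/
theorem ofClause_holeClause {n j i i' : ℕ} (h : xv n i j ≠ xv n i' j) :
    ofClause (holeClause n j i i') = ⟨-(e n i j + e n i' j), -1⟩ := by
  have hne : ((i * n + j, false) : Literal ℕ) ≠ (i' * n + j, false) := fun h' => h (by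
    simp only [xv]; exact (Prod.mk.inj h').1)
  have hset : (holeClause n j i i').toFinset = {(i * n + j, false), (i' * n + j, false)} := by
    simp [holeClause]
  unfold ofClause
  rw [hset]
  congr 1
  · rw [Finset.sum_pair hne]
    simp only [litCoeff, e, xv, Bool.false_eq_true, ↓reduceIte, neg_add_rev]
    rw [Finsupp.single_neg, Finsupp.single_neg, add_comm]
  · rw [Finset.filter_true_of_mem (fun l hl => by
      simp only [Finset.mem_insert, Finset.mem_singleton] at hl
      rcases hl with rfl | rfl <;> rfl), Finset.card_pair hne]
    norm_num

/-- The hole line `S j k`: `-∑_{i<k} x_{ij} ≥ -1`. [cite: CookCoullardTuran1987, §3] -/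
noncomputable def S (n j k : ℕ) : CPLine ℕ := ⟨-∑ i ∈ Finset.range k, e n i j, -1⟩

/-- The intermediate line `U j k r` (`r ≤ k`): `(k-1) · S j k` plus the hole axioms `(i, k)` for
`i < r`. [cite: CookCoullardTuran1987, §3] -/
noncomputable def U (n j k r : ℕ) : CPLine ℕ :=
  ⟨-(((k - 1 : ℕ) : ℤ) • ∑ i ∈ Finset.range k, e n i j + ∑ i ∈ Finset.range r, (e n i j + e n k j)),
    -((k - 1 : ℕ) : ℤ) - r⟩

/-- `S j 1` is the upper-bound axiom `-x_{0j} ≥ -1`. [folklore] -/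
theorem S_one (n j : ℕ) : S n j 1 = upper (xv n 0 j) := by
  unfold S upper e
  rw [Finset.sum_range_one, Finsupp.single_neg]

/-- `U j k 0 = (k - 1) · S j k`. [folklore] -/
theorem U_zero (n j k : ℕ) : U n j k 0 = smul (k - 1) (S n j k) := by
  unfold U S smul
  simp only [Finset.sum_range_zero, add_zero, smul_neg, CharP.cast_eq_zero, sub_zero, mul_neg, mul_one]

/-- `U j k (r+1) = U j k r + (hole axiom (r, k))`. [folklore] -/
theorem U_succ (n j k r : ℕ) : U n j k (r + 1) = U n j k r + ⟨-(e n r j + e n k j), -1⟩ := by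
  show U n j k (r + 1) = ⟨(U n j k r).coeff + -(e n r j + e n k j), (U n j k r).const + -1⟩
  unfold U
  simp only [Finset.sum_range_succ, Nat.cast_succ]
  congr 1
  · abel
  · ring

/-- The coefficients of `U j k k`: `-k ∑_{i ≤ k} x_{ij}`. [folklore] -/
theorem coeff_U_self (n j k : ℕ) (hk : 1 ≤ k) :
    (U n j k k).coeff = -((k : ℤ) • ∑ i ∈ Finset.range (k + 1), e n i j) := by
  unfold U
  simp only
  rw [Finset.sum_add_distrib, Finset.sum_const, Finset.card_range, Finset.sum_range_succ, smul_add,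
    Nat.cast_sub hk, Nat.cast_one]
  simp only [sub_smul, one_smul, ← natCast_zsmul]
  abel

/-- `⌈-(2k-1)/k⌉ = -1` (`k ≥ 1`). [folklore] -/
theorem ceilDiv_U_const (k : ℕ) (hk : 1 ≤ k) : ceilDiv (-((k - 1 : ℕ) : ℤ) - k) k = -1 := by
  unfold ceilDiv
  rw [Nat.cast_sub hk, Nat.cast_one]
  have h : -(-((k : ℤ) - 1) - k) = ((k : ℤ) - 1) + k * 1 := by ring
  rw [h, Int.add_mul_ediv_left _ _ (by omega), Int.ediv_eq_zero_of_lt (by omega) (by omega)]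
  norm_num

/-- **The division step**: `(U j k k) / k = S j (k+1)`. [cite: CookCoullardTuran1987, §3] -/
theorem divBy_U_self (n j k : ℕ) (hk : 1 ≤ k) : divBy k (U n j k k) = S n j (k + 1) := by
  have hc := coeff_U_self n j k hk
  unfold divBy S
  congr 1
  · rw [hc]
    ext v
    simp only [Finsupp.mapRange_apply, Finsupp.coe_neg, Finsupp.coe_smul, Pi.neg_apply, Pi.smul_apply,
      smul_eq_mul]
    rw [neg_mul_eq_mul_neg, Int.mul_ediv_cancel_left _ (by omega)]
  · exact ceilDiv_U_const k hk

/-- Divisibility of the coefficients of `U j k k` by `k`. [folklore] -/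
theorem dvd_coeff_U_self (n j k : ℕ) (hk : 1 ≤ k) (v : ℕ) : (k : ℤ) ∣ (U n j k k).coeff v := by
  rw [coeff_U_self n j k hk]
  simp only [Finsupp.coe_neg, Finsupp.coe_smul, Pi.neg_apply, Pi.smul_apply, smul_eq_mul]
  exact (dvd_mul_right _ _).neg_right

/-! ### Norm bookkeeping: the coefficient `ℓ¹`-mass is subadditive -/

/-- The coefficient `ℓ¹`-mass `∑_v |f v|` of a coefficient vector. [folklore] -/
noncomputable def mass (f : ℕ →₀ ℤ) : ℕ := f.sum fun _ a => a.natAbs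

/-- The norm of a line is `|b| +` the mass of its coefficients (definitional). [folklore] -/
theorem norm_eq_mass (L : CPLine ℕ) : L.norm = L.const.natAbs + mass L.coeff := rfl

/-- Mass as a sum over any finset containing the support. [folklore] -/
theorem mass_eq_sum {f : ℕ →₀ ℤ} {T : Finset ℕ} (h : f.support ⊆ T) : mass f = ∑ v ∈ T, (f v).natAbs := by
  unfold mass Finsupp.sum
  exact Finset.sum_subset h fun v _ hv => by rw [Finsupp.notMem_support_iff.1 hv]; rfl

/-- Mass is subadditive. [folklore] -/
theorem mass_add_le (f g : ℕ →₀ ℤ) : mass (f + g) ≤ mass f + mass g := by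
  classical
  have hT : (f + g).support ⊆ f.support ∪ g.support := Finsupp.support_add
  rw [mass_eq_sum hT, mass_eq_sum (Finset.subset_union_left (s₁ := f.support) (s₂ := g.support)),
    mass_eq_sum (Finset.subset_union_right (s₁ := f.support) (s₂ := g.support)), ← Finset.sum_add_distrib]
  exact Finset.sum_le_sum fun v _ => Int.natAbs_add_le _ _

/-- Mass of a negation. [folklore] -/
@[simp] theorem mass_neg (f : ℕ →₀ ℤ) : mass (-f) = mass f := by
  unfold mass
  rw [Finsupp.sum_neg_index (fun _ => rfl)]
  simp only [Int.natAbs_neg]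

/-- Mass of a natural multiple. [folklore] -/
theorem mass_nsmul_le (c : ℕ) (f : ℕ →₀ ℤ) : mass (c • f) ≤ c * mass f := by
  rw [mass_eq_sum (Finsupp.support_smul (b := c) (g := f)), mass, Finsupp.sum, Finset.mul_sum]
  refine Finset.sum_le_sum fun v _ => ?_
  rw [Finsupp.smul_apply, nsmul_eq_mul, Int.natAbs_mul, Int.natAbs_natCast]

/-- The sum of the unit vectors `x_p`, `p ∈ P` a set of (pigeon, hole) pairs. [folklore] -/
noncomputable def unitSum (n : ℕ) (P : Finset (ℕ × ℕ)) : ℕ →₀ ℤ := ∑ p ∈ P, e n p.1 p.2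

/-- A sum of unit vectors of distinct variables takes values in `{0, 1}`. [folklore] -/
theorem unitSum_apply {n : ℕ} {P : Finset (ℕ × ℕ)} (hP : ∀ p ∈ P, p.2 < n) (v : ℕ) :
    unitSum n P v = if v ∈ P.image (fun p => xv n p.1 p.2) then 1 else 0 := by
  unfold unitSum
  rw [Finsupp.finsetSum_apply]
  simp only [e, Finsupp.single_apply]
  rw [Finset.sum_boole]
  split_ifs with h
  · obtain ⟨p, hp, rfl⟩ := Finset.mem_image.1 h
    have : (P.filter fun q => xv n q.1 q.2 = xv n p.1 p.2) = {p} := by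
      refine Finset.eq_singleton_iff_unique_mem.2 ⟨Finset.mem_filter.2 ⟨hp, rfl⟩, fun q hq => ?_⟩
      rw [Finset.mem_filter] at hq
      obtain ⟨h1, h2⟩ := xv_inj (hP q hq.1) (hP p hp) hq.2
      exact Prod.ext h1 h2
    rw [this, Finset.card_singleton]; rfl
  · have : (P.filter fun q => xv n q.1 q.2 = v) = ∅ :=
      Finset.filter_eq_empty_iff.2 fun q hq heq => h (Finset.mem_image.2 ⟨q, hq, heq⟩)
    rw [this, Finset.card_empty]; rfl

/-- The mass of a sum of unit vectors of distinct variables is at most the number of terms.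
[folklore] -/
theorem mass_unitSum_le {n : ℕ} {P : Finset (ℕ × ℕ)} (hP : ∀ p ∈ P, p.2 < n) : mass (unitSum n P) ≤ P.card := by
  classical
  have hsupp : (unitSum n P).support ⊆ P.image (fun p => xv n p.1 p.2) := by
    intro v hv
    rw [Finsupp.mem_support_iff, unitSum_apply hP] at hv
    by_contra h
    rw [if_neg h] at hv
    exact hv rfl
  rw [mass_eq_sum hsupp]
  calc ∑ v ∈ P.image (fun p => xv n p.1 p.2), (unitSum n P v).natAbs
      ≤ ∑ v ∈ P.image (fun p => xv n p.1 p.2), 1 := Finset.sum_le_sum fun v hv => by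
          rw [unitSum_apply hP, if_pos hv]; rfl
    _ = (P.image fun p => xv n p.1 p.2).card := by simp
    _ ≤ P.card := Finset.card_image_le

/-- Row sums are unit sums. [folklore] -/
theorem sum_e_eq_unitSum_row (n j : ℕ) (s : Finset ℕ) : ∑ i ∈ s, e n i j = unitSum n (s ×ˢ {j}) := by
  unfold unitSum; rw [Finset.sum_product]; simp

/-- Column sums are unit sums. [folklore] -/
theorem sum_e_eq_unitSum_col (n i : ℕ) (t : Finset ℕ) : ∑ j ∈ t, e n i j = unitSum n ({i} ×ˢ t) := by
  unfold unitSum; rw [Finset.sum_product]; simp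

/-- Double sums are unit sums. [folklore] -/
theorem sum_sum_e_eq_unitSum (n : ℕ) (s t : Finset ℕ) :
    ∑ i ∈ s, ∑ j ∈ t, e n i j = unitSum n (s ×ˢ t) := by
  unfold unitSum; rw [Finset.sum_product]

/-- Double sums (holes outside) are unit sums. [folklore] -/
theorem sum_sum_e_eq_unitSum' (n : ℕ) (s t : Finset ℕ) :
    ∑ j ∈ t, ∑ i ∈ s, e n i j = unitSum n (s ×ˢ t) := by
  rw [Finset.sum_comm]; exact sum_sum_e_eq_unitSum n s t

/-- Norm of the hole line `S j k`: `≤ 1 + k`. [folklore] -/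
theorem norm_S_le {n j : ℕ} (hj : j < n) (k : ℕ) : (S n j k).norm ≤ 1 + k := by
  rw [norm_eq_mass]
  unfold S
  rw [mass_neg, sum_e_eq_unitSum_row]
  refine Nat.add_le_add (by norm_num) ((mass_unitSum_le fun p hp => ?_).trans (by simp))
  simp only [Finset.mem_product, Finset.mem_singleton] at hp
  rw [hp.2]; exact hj

/-- Norm of a hole axiom line: `≤ 3`. [folklore] -/
theorem norm_hole_le {n j : ℕ} (hj : j < n) (i i' : ℕ) :
    (⟨-(e n i j + e n i' j), -1⟩ : CPLine ℕ).norm ≤ 3 := by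
  rw [norm_eq_mass]
  have h : e n i j + e n i' j = unitSum n {(i, j)} + unitSum n {(i', j)} := by simp [unitSum]
  simp only [Int.reduceNeg, Int.reduceAbs, h, mass_neg]
  have h1 := mass_unitSum_le (n := n) (P := {(i, j)}) (by simp [hj])
  have h2 := mass_unitSum_le (n := n) (P := {(i', j)}) (by simp [hj])
  have := mass_add_le (unitSum n {(i, j)}) (unitSum n {(i', j)})
  simp only [Finset.card_singleton] at h1 h2
  omega

/-- Norm of the intermediate line `U j k r` (`r ≤ k`): `≤ k² + 3 k`. [folklore] -/
theorem norm_U_le {n j k r : ℕ} (hj : j < n) (hr : r ≤ k) : (U n j k r).norm ≤ k * k + 3 * k := by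
  rw [norm_eq_mass]
  unfold U
  rw [mass_neg, Finset.sum_add_distrib, Finset.sum_const, Finset.card_range]
  have hA := mass_unitSum_le (n := n) (P := Finset.range k ×ˢ {j}) (fun p hp => by
    simp only [Finset.mem_product, Finset.mem_singleton] at hp; rw [hp.2]; exact hj)
  have hB := mass_unitSum_le (n := n) (P := Finset.range r ×ˢ {j}) (fun p hp => by
    simp only [Finset.mem_product, Finset.mem_singleton] at hp; rw [hp.2]; exact hj)
  have hC := mass_unitSum_le (n := n) (P := {(k, j)}) (by simp [hj])
  simp only [Finset.card_product, Finset.card_range, Finset.card_singleton, mul_one] at hA hB hC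
  have hCe : e n k j = unitSum n {(k, j)} := by simp [unitSum]
  rw [sum_e_eq_unitSum_row, sum_e_eq_unitSum_row, hCe, natCast_zsmul]
  have e1 : mass ((k - 1) • unitSum n (Finset.range k ×ˢ {j}) +
      (unitSum n (Finset.range r ×ˢ {j}) + r • unitSum n {(k, j)})) ≤ (k - 1) * k + (r + r) := by
    refine (mass_add_le _ _).trans (Nat.add_le_add ((mass_nsmul_le _ _).trans (Nat.mul_le_mul_left _ hA))
      ((mass_add_le _ _).trans (Nat.add_le_add hB ((mass_nsmul_le _ _).trans ?_))))
    simpa using Nat.mul_le_mul_left r hC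
  have e2 : (-((k - 1 : ℕ) : ℤ) - (r : ℤ)).natAbs = (k - 1) + r := by omega
  rw [e2]
  rcases k with _ | k
  · simp at hr; subst hr; simpa using e1
  · simp only [Nat.add_sub_cancel] at e1 ⊢
    nlinarith [e1, hr]

/-- The hole sum `H r = ∑_{j<r} S j m`: `-∑_{i<m, j<r} x_{ij} ≥ -r`. [cite: CookCoullardTuran1987, §3] -/
noncomputable def H (m n r : ℕ) : CPLine ℕ := ⟨-∑ j ∈ Finset.range r, ∑ i ∈ Finset.range m, e n i j, -r⟩

/-- The pigeon sum `G r = ∑_{i<r} (pigeon axiom i)`: `∑_{i<r, j<n} x_{ij} ≥ r`. [cite: CookCoullardTuran1987, §3] -/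
noncomputable def G (n r : ℕ) : CPLine ℕ := ⟨∑ i ∈ Finset.range r, ∑ j ∈ Finset.range n, e n i j, r⟩

/-- `H 1 = S 0 m`. [folklore] -/
theorem H_one (m n : ℕ) : H m n 1 = S n 0 m := by
  unfold H S; rw [Finset.sum_range_one]; norm_num

/-- `H (r+1) = H r + S r m`. [folklore] -/
theorem H_succ (m n r : ℕ) : H m n (r + 1) = H m n r + S n r m := by
  show H m n (r + 1) = ⟨(H m n r).coeff + (S n r m).coeff, (H m n r).const + (S n r m).const⟩
  unfold H S
  simp only [Finset.sum_range_succ, neg_add_rev, Nat.cast_succ]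
  congr 1
  · abel
  · ring

/-- `G 1` is the pigeon axiom of pigeon `0`. [folklore] -/
theorem G_one (n : ℕ) : G n 1 = ofClause (pigeonClause n 0) := by
  rw [ofClause_pigeonClause]; unfold G; rw [Finset.sum_range_one]; norm_num

/-- `G (r+1) = G r + (pigeon axiom r)`. [folklore] -/
theorem G_succ (n r : ℕ) : G n (r + 1) = G n r + ofClause (pigeonClause n r) := by
  rw [ofClause_pigeonClause]
  show G n (r + 1) = ⟨(G n r).coeff + ∑ j ∈ Finset.range n, e n r j, (G n r).const + 1⟩
  unfold G
  simp only [Finset.sum_range_succ, Nat.cast_succ]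

/-- **The contradiction**: `G m + H n = (0 ≥ m - n)`. [cite: CookCoullardTuran1987, §3] -/
theorem G_add_H (m n : ℕ) : G n m + H m n n = ⟨0, (m : ℤ) - n⟩ := by
  show (⟨(G n m).coeff + (H m n n).coeff, (G n m).const + (H m n n).const⟩ : CPLine ℕ) = ⟨0, (m : ℤ) - n⟩
  unfold G H
  simp only
  rw [Finset.sum_comm (s := Finset.range n), add_neg_cancel]
  rfl

/-- Norm of a pigeon axiom: `≤ 1 + n`. [folklore] -/
theorem norm_pigeon_le (n i : ℕ) : (ofClause (pigeonClause n i)).norm ≤ 1 + n := by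
  rw [ofClause_pigeonClause, norm_eq_mass]
  simp only [Int.natAbs_one]
  rw [sum_e_eq_unitSum_col]
  refine Nat.add_le_add_left ((mass_unitSum_le fun p hp => ?_).trans (by simp)) _
  simp only [Finset.mem_product, Finset.mem_singleton, Finset.mem_range] at hp
  exact hp.2

/-- Norm of `G r`: `≤ r + r n`. [folklore] -/
theorem norm_G_le (n r : ℕ) : (G n r).norm ≤ r + r * n := by
  rw [norm_eq_mass]
  unfold G
  simp only [Int.natAbs_natCast]
  rw [sum_sum_e_eq_unitSum]
  refine Nat.add_le_add_left ((mass_unitSum_le fun p hp => ?_).trans (by simp)) _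
  simp only [Finset.mem_product, Finset.mem_range] at hp
  exact hp.2

/-- Norm of `H r` (`r ≤ n`): `≤ r + r m`. [folklore] -/
theorem norm_H_le {m n r : ℕ} (hr : r ≤ n) : (H m n r).norm ≤ r + r * m := by
  rw [norm_eq_mass]
  unfold H
  simp only [Int.natAbs_neg, Int.natAbs_natCast, mass_neg]
  rw [sum_sum_e_eq_unitSum']
  refine Nat.add_le_add_left ((mass_unitSum_le fun p hp => ?_).trans (by simp [mul_comm])) _
  simp only [Finset.mem_product, Finset.mem_range] at hp
  exact hp.2.trans_le hr

/-! ### The tree-like derivation -/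

section Tree

variable {m n : ℕ}

/-- The norm budget `W = 4 (m + n + 1)²`. [folklore] -/
def W (m n : ℕ) : ℕ := 4 * (m + n + 1) ^ 2

/-- `k² + 3k ≤ W` for `k ≤ m`. [folklore] -/
theorem sq_le_W {k : ℕ} (hk : k ≤ m) : k * k + 3 * k ≤ W m n := by
  unfold W
  have h1 : k * k ≤ (m + n + 1) * (m + n + 1) := Nat.mul_le_mul (by omega) (by omega)
  have h2 : 3 * k ≤ 3 * ((m + n + 1) * (m + n + 1)) := by nlinarith
  rw [sq]; omega

/-- `r + r m ≤ W` and `r + r n ≤ W` for `r ≤ m + n + 1`. [folklore] -/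
theorem lin_le_W {r a : ℕ} (hr : r ≤ m + n + 1) (ha : a ≤ m + n + 1) : r + r * a ≤ W m n := by
  unfold W
  have h1 : r * a ≤ (m + n + 1) * (m + n + 1) := Nat.mul_le_mul hr ha
  have h2 : r ≤ (m + n + 1) * (m + n + 1) := hr.trans (Nat.le_mul_self _)
  rw [sq]; omega

/-- **The hole derivation**: for `j < n` and `1 ≤ k ≤ m`, the line `-∑_{i<k} x_{ij} ≥ -1` has a
tree-like derivation from `PHP^m_n` with `k² + k - 1` lines of norm `≤ W`.
[cite: CookCoullardTuran1987, §3] -/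
theorem tree_S {j : ℕ} (hj : j < n) : ∀ k, 1 ≤ k → k ≤ m → CPTree (pigeonholeCNF m n) (W m n) (S n j k) (k * k + k - 1)
  | 0, h, _ => absurd h (by omega)
  | 1, _, hm => by
    have h := CPTree.upper (φ := pigeonholeCNF m n) (W := W m n) (xv n 0 j)
      (by rw [← S_one]; exact (norm_S_le hj 1).trans ((show 1 + 1 ≤ 1 * 1 + 3 * 1 by norm_num).trans (sq_le_W hm)))
    rw [← S_one] at h
    exact h
  | k + 2, _, hm => by
    have hk : 1 ≤ k + 1 := by omega
    have ih := tree_S hj (k + 1) hk (by omega)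
    have hUW : ∀ r, r ≤ k + 1 → (U n j (k + 1) r).norm ≤ W m n := fun r hr =>
      (norm_U_le hj hr).trans (sq_le_W (by omega))
    -- multiply by `k`
    have hz : U n j (k + 1) 0 = smul k (S n j (k + 1)) := by rw [U_zero, Nat.add_sub_cancel]
    have hT : CPTree (pigeonholeCNF m n) (W m n) (U n j (k + 1) 0) (((k + 1) * (k + 1) + (k + 1) - 1) + 1) := by
      rw [hz]
      exact CPTree.mul k ih (by rw [← hz]; exact hUW 0 (Nat.zero_le _))
    -- add the `k+1` hole axioms `(i, k+1)`, `i < k+1`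
    have hU : ∀ r, r ≤ k + 1 → CPTree (pigeonholeCNF m n) (W m n) (U n j (k + 1) r)
        (((k + 1) * (k + 1) + (k + 1) - 1) + 1 + 2 * r) := by
      intro r
      induction r with
      | zero => intro _; simpa using hT
      | succ r ihr =>
        intro hr
        have hQ : CPTree (pigeonholeCNF m n) (W m n) ⟨-(e n r j + e n (k + 1) j), -1⟩ 1 := by
          have hne : xv n r j ≠ xv n (k + 1) j := fun h => by
            have := (xv_inj hj hj h).1; omega
          rw [← ofClause_holeClause hne]
          refine CPTree.initial (holeClause_mem hj (by omega) (by omega)) ?_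
          rw [ofClause_holeClause hne]
          exact (norm_hole_le hj _ _).trans (by unfold W; nlinarith)
        have h := CPTree.add (ihr (by omega)) hQ (by rw [← U_succ]; exact hUW (r + 1) hr)
        rw [← U_succ] at h
        exact h.of_eq_of_eq rfl (by ring)
    -- divide by `k + 1`
    have hD := CPTree.div (k + 1) (by omega) (dvd_coeff_U_self n j (k + 1) hk) (hU (k + 1) le_rfl)
      (by rw [divBy_U_self n j (k + 1) hk]; exact (norm_S_le hj _).trans ((by nlinarith : 1 + (k + 1 + 1) ≤ (k + 2) * (k + 2) + 3 * (k + 2)).trans (sq_le_W hm)))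
    rw [divBy_U_self n j (k + 1) hk] at hD
    exact hD.of_eq_of_eq rfl (by ring_nf; omega)

/-- **The hole sums**: `H r`, `1 ≤ r ≤ n`, with `r (m² + m - 1) + (r - 1)` lines (for `m ≥ 1`).
[cite: CookCoullardTuran1987, §3] -/
theorem tree_H (hm : 1 ≤ m) : ∀ r, 1 ≤ r → r ≤ n →
    CPTree (pigeonholeCNF m n) (W m n) (H m n r) (r * (m * m + m - 1) + (r - 1))
  | 0, h, _ => absurd h (by omega)
  | 1, _, hn => by
    have h := tree_S (m := m) (n := n) (j := 0) (by omega) m hm le_rfl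
    rw [← H_one] at h
    exact h.of_eq_of_eq rfl (by simp)
  | r + 2, _, hn => by
    have ih := tree_H hm (r + 1) (by omega) (by omega)
    have hS := tree_S (m := m) (n := n) (j := r + 1) (by omega) m hm le_rfl
    have h := CPTree.add ih hS (by rw [← H_succ]; exact (norm_H_le (by omega)).trans (lin_le_W (by omega) (by omega)))
    rw [← H_succ] at h
    have hm1 : 1 ≤ m * m + m := by nlinarith
    exact h.of_eq_of_eq rfl (by
      zify [hm1, (show 1 ≤ r + 1 by omega), (show 1 ≤ r + 2 by omega)]
      ring)

/-- **The pigeon sums**: `G r`, `1 ≤ r ≤ m`, with `2 r - 1` lines. [cite: CookCoullardTuran1987, §3] -/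
theorem tree_G : ∀ r, 1 ≤ r → r ≤ m → CPTree (pigeonholeCNF m n) (W m n) (G n r) (2 * r - 1)
  | 0, h, _ => absurd h (by omega)
  | 1, _, hm => by
    have h := CPTree.initial (φ := pigeonholeCNF m n) (W := W m n) (pigeonClause_mem (n := n) (by omega : 0 < m))
      (by rw [← G_one]; exact (norm_G_le n 1).trans (lin_le_W (by omega) (by omega)))
    rw [← G_one] at h
    exact h
  | r + 2, _, hm => by
    have ih := tree_G (r + 1) (by omega) (by omega)
    have hP := CPTree.initial (φ := pigeonholeCNF m n) (W := W m n) (pigeonClause_mem (n := n) (by omega : r + 1 < m))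
      ((norm_pigeon_le n (r + 1)).trans (by
        have := lin_le_W (m := m) (n := n) (r := 1) (a := n) (by omega) (by omega); omega))
    have h := CPTree.add ih hP (by rw [← G_succ]; exact (norm_G_le n (r + 2)).trans (lin_le_W (by omega) (by omega)))
    rw [← G_succ] at h
    exact h.of_eq_of_eq rfl (by omega)

end Tree

end PigeonholeCP

open PigeonholeCP

/-- **Polynomial-size cutting planes refutations of the pigeonhole principle**
(Cook–Coullard–Turán 1987, §3): for `n < m`, `PHP^m_n` has a cutting planes refutation with at
most `(m + n + 1)³` lines, all of `ℓ¹`-norm at most `4 (m + n + 1)²` (in particular with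
coefficients of absolute value `≤ 4 (m + n + 1)²`: a `CP*` refutation).
[cite: CookCoullardTuran1987, §3] -/
theorem pigeonhole_cuttingPlanes_upperBound {m n : ℕ} (hnm : n < m) :
    ∃ π : List (CPStep ℕ), IsCPRefutation (pigeonholeCNF m n) π ∧
      π.length ≤ (m + n + 1) ^ 3 ∧ cpNorm π ≤ 4 * (m + n + 1) ^ 2 := by
  rcases Nat.eq_zero_or_pos n with rfl | hn
  · -- no holes: the pigeon clause of pigeon `0` is empty
    have hmem : pigeonClause 0 0 ∈ pigeonholeCNF m 0 := pigeonClause_mem hnm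
    have hempty : pigeonClause 0 0 = [] := rfl
    have hline : ofClause (pigeonClause 0 0) = (⟨0, 1⟩ : CPLine ℕ) := by
      rw [hempty]; unfold ofClause; simp
    have hn1 : CPLine.norm (⟨0, 1⟩ : CPLine ℕ) = 1 := by unfold CPLine.norm; simp
    have h4 : 1 ≤ 4 * (m + 0 + 1) ^ 2 := by nlinarith [Nat.one_le_pow 2 (m + 0 + 1) (by omega)]
    have htree : CPTree (pigeonholeCNF m 0) (4 * (m + 0 + 1) ^ 2) (ofClause (pigeonClause 0 0)) 1 :=
      CPTree.initial hmem (by rw [hline, hn1]; exact h4)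
    obtain ⟨π, hπ, hlen, hnorm⟩ := htree.exists_isCPRefutation (by rw [hline]; exact ⟨rfl, one_pos⟩)
    exact ⟨π, hπ, by rw [hlen]; nlinarith, hnorm⟩
  · have hm : 1 ≤ m := by omega
    have hG := tree_G (m := m) (n := n) m hm le_rfl
    have hH := tree_H (m := m) (n := n) hm n hn le_rfl
    have hfin := CPTree.add hG hH (by
      rw [G_add_H]; unfold CPLine.norm W
      have h1 : ((m : ℤ) - n).natAbs ≤ m := by omega
      have h2 : m ≤ 4 * (m + n + 1) ^ 2 := by nlinarith
      simp; omega)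
    rw [G_add_H] at hfin
    obtain ⟨π, hπ, hlen, hnorm⟩ := hfin.exists_isCPRefutation ⟨rfl, show (0 : ℤ) < (m : ℤ) - n by omega⟩
    refine ⟨π, hπ, ?_, hnorm⟩
    rw [hlen]
    have h1 : 2 * m - 1 + (n * (m * m + m - 1) + (n - 1)) + 1 ≤ 2 * m + n * (m * m + m) + n := by
      have : n * (m * m + m - 1) ≤ n * (m * m + m) := Nat.mul_le_mul_left _ (Nat.sub_le _ _)
      omega
    refine h1.trans ?_
    have key : (m + n + 1) ^ 3 = m ^ 3 + n ^ 3 + 1 + 3 * (m ^ 2 * n) + 3 * (m * n ^ 2) + 3 * m ^ 2 +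
        3 * n ^ 2 + 3 * m + 3 * n + 6 * (m * n) := by ring
    rw [key]
    nlinarith [Nat.zero_le (m ^ 2 * n), Nat.zero_le (m * n ^ 2), Nat.zero_le (m * n), Nat.zero_le (m ^ 3),
      Nat.zero_le (n ^ 3), Nat.zero_le (m ^ 2), Nat.zero_le (n ^ 2)]

/-- **Cutting planes is exponentially stronger than resolution on the pigeonhole principle**
(Cook–Coullard–Turán 1987 + Haken 1985): there is `c > 1` such that for every `n`, `PHP^{n+1}_n`
has a cutting planes refutation with at most `(2n + 2)³` lines of norm `≤ 4 (2n + 2)²`, while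
every resolution refutation of it has at least `c^n` lines (`haken_pigeonhole_holds`).
[cite: CookCoullardTuran1987, §3] [cite: Haken1985, §2.1] -/
theorem cuttingPlanes_exponential_speedup_pigeonhole :
    ∃ c : ℝ, 1 < c ∧ ∀ n : ℕ,
      (∃ π : List (CPStep ℕ), IsCPRefutation (pigeonholeCNF (n + 1) n) π ∧
        π.length ≤ (2 * n + 2) ^ 3 ∧ cpNorm π ≤ 4 * (2 * n + 2) ^ 2) ∧
      ∀ π : List (ResLine ℕ), IsResRefutation (pigeonholeCNF (n + 1) n) π → c ^ n ≤ (π.length : ℝ) := by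
  obtain ⟨c, hc, h⟩ := haken_pigeonhole_holds
  refine ⟨c, hc, fun n => ⟨?_, h n⟩⟩
  obtain ⟨π, hπ, hlen, hnorm⟩ := pigeonhole_cuttingPlanes_upperBound (Nat.lt_succ_self n)
  refine ⟨π, hπ, ?_, ?_⟩
  · rw [show 2 * n + 2 = n + 1 + n + 1 by ring]; exact hlen
  · rw [show 2 * n + 2 = n + 1 + n + 1 by ring]; exact hnorm

end Literature.Computability.MetaComplexity
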